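import Literature.NumberTheory.GaloisCohomology.Howard2004.DVRKolyvaginBound
import Literature.NumberTheory.GaloisCohomology.Howard2004.TowerReindex
import Literature.NumberTheory.EllipticCurves.HeegnerPointsKolyvaginCebotarevProofs
import Literature.NumberTheory.GaloisRepresentations.EulerSystem
import Literature.NumberTheory.GaloisRepresentations.IntegralGaloisActionProofs
import HarnessLib

/-!
# Howard 2004, §1.6: «`ℓ ∈ 𝓛_{2k−1}(T)`» — a Čebotarev prime whose Frobenius acts trivially on ONE
# level of the `𝔪`-adic tower is a Kolyvagin prime `λ ∈ 𝓛_s(T)` of the whole tower (DVRSetting)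

Topic `NumberTheory/GaloisCohomology/Howard2004` (the junction between Lemma 1.6.2's output — an inert
prime `λ` with a Frobenius in `Γ_L`, `L ⊇ K(T^{(j)})` — and the hypothesis «`𝓛_s(T) ⊂ 𝓛` for
`s ≫ 0`» (`DVRSetting.LargePrimes`) of Theorem 1.6.1 = the print leaf G87
`Howard2004.thm161_dvrKolyvaginBound`; cell `pub/bsd-print-x9`, seat `bsd-line-x10b-p1-w6` g8).
THEOREMS ONLY: no definition, no named fact, no instance, no notation, no `sorry`.

Printed source.  B. Howard, *The Heegner point Kolyvagin system*, Compositio Math. **140** (2004) =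
arXiv:1202.6340: Def. 1.2.1 (arXiv 2.2.1, p. 6 L63–70) «`I_ℓ` = the smallest ideal of `R`
containing `ℓ + 1` for which `Frob_λ` acts trivially on `T/I_ℓT`; `𝓛_k(T) = {ℓ ∈ 𝓛₀ ∣ I_ℓ ⊂ p^k ℤ_p}`»;
§1.6 (arXiv p. 11 L13–16, L33–38) «suppose `𝓛_s(T) ⊂ 𝓛` for `s ≫ 0` … `𝓛^{(k)} = 𝓛 ∩ 𝓛_k(T)`»;
Lemma 1.6.2 (arXiv 2.6.2, p. 11 L48–58) «primes `ℓ` of `ℚ` whose Frobenius class in `Gal(E/ℚ)`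
is equal to `τσ`», `E ⊇ L ⊇ K(T^{(2k−1)}, μ_{p^{2k−1}})`, so that `λ ∈ 𝓛^{(2k−1)}`.

What is here, on a `DVRSetting` `S` with `S.SatisfiesH` (tree currency `AdicTower.kolyvaginPrimes`,
whose clause «`Frob_λ ≡ 1 (mod p^s)`» is imposed at EVERY level `T^{(k)}` and for EVERY
arithmetic Frobenius at `λ`):
* §1 `ker_redIter_le` — the iterated reduction `T^{(j+d)} → T^{(j)}` has kernel inside
  `𝔪^{e_j} T^{(j+d)}` (exact tower); `sub_mem_pow_smul_top_of_forall_apply_eq` — if `σ` acts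
  trivially on the level `T^{(j)}` then `σ x − x ∈ 𝔪^{e_j} T^{(k)}` at EVERY level `k`;
* §2 `exists_maximalIdeal_pow_e_le_span_pow` — when `p ≠ 0` in `R` (char. 0; Howard's «cases of
  interest»), some level has `𝔪^{e_j} ⊆ p^s R` (every non-zero ideal of a DVR is a power of `𝔪`);
* §3 `forall_apply_eq_of_isArithFrobAtPlace` — if ONE arithmetic Frobenius at `λ` acts trivially
  on the unramified level `T^{(j)}`, EVERY arithmetic Frobenius at `λ` does (conjugate primes,
  inertia acts trivially);
* §4 `isDegreeTwo_of_span_natCast_isPrime` — an inert rational prime of a quadratic field is a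
  degree-two place; **`mem_kolyvaginPrimes_of_isArithFrobAtPlace`** — «`λ ∈ 𝓛_s(T)`»: `ℓ ≠ p`
  inert, `λ ∉ Σ(F)`, `p^s ∣ ℓ + 1`, `𝔪^{e_j} ⊆ (p^s)`, and a Frobenius at `λ` trivial on `T^{(j)}`
  give `λ ∈ S.T.kolyvaginPrimes p s`; `mem_primes_of_isArithFrobAtPlace` — hence `λ ∈ 𝓛` under
  `LargePrimes` (`s ≥ s₀`).

HONEST FRAMING / FINDING.  §2 needs `(p : R) ≠ 0`: for a coefficient DVR of characteristic `p`
(admitted by the typing, e.g. `𝔽_q[[t]]`; Howard §3.1 applies Thm. 1.6.1 only at height-one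
primes `𝔭 ≠ pΛ`) `Ideal.span {p^s} = ⊥` and `𝓛_s(T)` demands a Frobenius trivial on EVERY level,
which a finite-level Čebotarev argument cannot supply.  Not Lemma 1.6.2 / 1.6.4 / Thm. 1.6.1; no
summit statement is proved; the Birch–Swinnerton-Dyer conjecture is not proved by any of this.

References: [Howard2004HeegnerKolyvagin] Def. 1.2.1, §1.6, Lemma 1.6.2; [NeukirchANT1999] I §9.
-/

set_option autoImplicit false

noncomputable section

open Function NumberField IsDedekindDomain Field
open scoped NumberField ContRepresentation Classical Pointwise

namespace Literature.NumberTheory.GaloisCohomology.Howard2004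

open Literature.NumberTheory.GaloisRepresentations
open Literature.NumberTheory.GaloisRepresentations.DiscreteGaloisModule
open Literature.NumberTheory.EllipticCurves

section DegreeTwo

variable {K : Type} [Field K] [NumberField K]

/-- **An inert rational prime of a quadratic field is a degree-two place**: if `(ℓ) = ℓ𝓞_K` is
prime and `λ ∋ ℓ`, then `#(𝓞_K/λ) = ℓ² = (char 𝓞_K/λ)²` (`IsDegreeTwo`).
[cite: Howard2004HeegnerKolyvagin, §1.2 (arXiv p. 6 L57–58: «degree two primes of K»)] -/
theorem isDegreeTwo_of_span_natCast_isPrime (hK2 : Module.finrank ℚ K = 2) {ℓ : ℕ} (hℓ : ℓ.Prime)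
    (hinert : (Ideal.span {(ℓ : 𝓞 K)}).IsPrime) {v : HeightOneSpectrum (𝓞 K)}
    (hℓv : (ℓ : 𝓞 K) ∈ v.asIdeal) : IsDegreeTwo v := by
  -- `v = (ℓ)`
  have hne : Ideal.span {(ℓ : 𝓞 K)} ≠ ⊥ := by
    rw [Ne, Ideal.span_singleton_eq_bot]; exact_mod_cast hℓ.ne_zero
  have hmax : (Ideal.span {(ℓ : 𝓞 K)}).IsMaximal := hinert.isMaximal hne
  have heq : v.asIdeal = Ideal.span {(ℓ : 𝓞 K)} :=
    (hmax.eq_of_le v.isPrime.ne_top ((Ideal.span_singleton_le_iff_mem _).mpr hℓv)).symm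
  -- the residue characteristic is `ℓ`
  haveI : Nontrivial (𝓞 K ⧸ v.asIdeal) := Ideal.Quotient.nontrivial_iff.mpr v.isPrime.ne_top
  have hchar : residueChar v = ℓ := by
    have h0 : ((ℓ : ℕ) : 𝓞 K ⧸ v.asIdeal) = 0 := by
      rw [← map_natCast (Ideal.Quotient.mk v.asIdeal), Ideal.Quotient.eq_zero_iff_mem]
      exact hℓv
    exact (CharP.ringChar_of_prime_eq_zero hℓ h0)
  -- `#(𝓞_K/(ℓ)) = ℓ²`
  rw [IsDegreeTwo, hchar, ← Submodule.cardQuot_apply, ← Ideal.absNorm_apply, heq,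
    Ideal.absNorm_span_singleton,
    show (ℓ : 𝓞 K) = algebraMap ℤ (𝓞 K) (ℓ : ℤ) by simp, Algebra.norm_algebraMap,
    NumberField.RingOfIntegers.rank, hK2, Int.natAbs_pow, Int.natAbs_natCast]

end DegreeTwo

namespace DVRSetting

variable {p : ℕ} [Fact p.Prime] {K : Type} [Field K] [NumberField K]
  {R : Type} [CommRing R] [IsDomain R] [IsDiscreteValuationRing R] [Algebra ℤ_[p] R]
  {N : ℕ → Type} [∀ k, AddCommGroup (N k)] [∀ k, TopologicalSpace (N k)]
  [∀ k, DiscreteTopology (N k)] [∀ k, Module R (N k)]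
  {Rk : ℕ → Type} [∀ k, CommRing (Rk k)] [∀ k, IsLocalRing (Rk k)] [∀ k, TopologicalSpace (Rk k)]
  [∀ k, DiscreteTopology (Rk k)] [∀ k, Algebra ℤ_[p] (Rk k)] [∀ k, Algebra R (Rk k)]
  [∀ k, Module (Rk k) (N k)] [∀ k, IsScalarTower R (Rk k) (N k)]
  {Nbar : Type} [AddCommGroup Nbar] [TopologicalSpace Nbar] [DiscreteTopology Nbar]
  [∀ k, Module (Rk k) Nbar]
  {Nq : ℕ → Finset (HeightOneSpectrum (𝓞 K)) → Type} [∀ k n, AddCommGroup (Nq k n)]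
  [∀ k n, TopologicalSpace (Nq k n)] [∀ k n, DiscreteTopology (Nq k n)]
  [∀ k n, Module (Rk k) (Nq k n)] [∀ k n, Module R (Nq k n)]
  [∀ k n, IsScalarTower R (Rk k) (Nq k n)]

/-! ## §1 The exact tower: kernels of iterated reductions; trivial on one level ⇒ `≡ 1 (mod 𝔪^{e_j})` on all -/

/-- **`ker(T^{(j+d)} → T^{(j)}) ⊆ 𝔪^{e_j} T^{(j+d)}`** for the exact tower of a `DVRSetting`
(`ker red_k = 𝔪^{e_k} T^{(k+1)}`, `e` increasing), by induction on `d`.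
[cite: Howard2004HeegnerKolyvagin, §1.6 (arXiv p. 11 L33–36: `T^{(k)} = T/𝔪^k T`)] -/
theorem ker_redIter_le (S : DVRSetting p K R N Rk Nbar Nq) (hy : S.SatisfiesH) (j : ℕ) :
    ∀ d : ℕ, LinearMap.ker (S.T.redIter j d) ≤
      (IsLocalRing.maximalIdeal R ^ S.e j) • (⊤ : Submodule R (N (j + d)))
  | 0 => by
    intro x hx
    rw [LinearMap.mem_ker] at hx
    change x = 0 at hx
    rw [hx]
    exact Submodule.zero_mem _
  | d + 1 => by
    intro x hx
    rw [LinearMap.mem_ker, AdicTower.redIter_succ] at hx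
    have h1 : S.T.red (j + d) x ∈ (IsLocalRing.maximalIdeal R ^ S.e j) • (⊤ : Submodule R (N (j + d))) :=
      ker_redIter_le S hy j d (LinearMap.mem_ker.mpr hx)
    -- lift along the surjection `red_{j+d}`: `𝔪^{e_j} T^{(j+d)} = red (𝔪^{e_j} T^{(j+d+1)})`
    have hmap : (IsLocalRing.maximalIdeal R ^ S.e j) • (⊤ : Submodule R (N (j + d))) =
        ((IsLocalRing.maximalIdeal R ^ S.e j) • (⊤ : Submodule R (N (j + d + 1)))).map
          (S.T.red (j + d)) := by
      rw [Submodule.map_smul'', Submodule.map_top, LinearMap.range_eq_top.mpr (S.T.red_surjective _)]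
    rw [hmap] at h1
    obtain ⟨y, hy1, hyx⟩ := h1
    have hker : x - y ∈ LinearMap.ker (S.T.red (j + d)) := by
      rw [LinearMap.mem_ker, map_sub, hyx, sub_self]
    rw [hy.ker_red (j + d)] at hker
    have hle : (IsLocalRing.maximalIdeal R ^ S.e (j + d)) • (⊤ : Submodule R (N (j + d + 1))) ≤
        (IsLocalRing.maximalIdeal R ^ S.e j) • ⊤ :=
      Submodule.smul_mono_left (Ideal.pow_le_pow_right (hy.e_strictMono.monotone (Nat.le_add_right j d)))
    have hx' : x = (x - y) + y := by abel
    rw [hx']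
    exact Submodule.add_mem _ (hle hker) hy1

/-- **Trivial on one level ⇒ `σ x − x ∈ 𝔪^{e_j} T^{(k)}` on every level.**  If `σ ∈ Γ_K` acts
trivially on `T^{(j)}`, then for every `k` and `x ∈ T^{(k)}`, `σx − x ∈ 𝔪^{e_j} T^{(k)}` (for
`k ≤ j` the level is a quotient of `T^{(j)}`, so `σx = x`; for `k ≥ j` the difference dies in
`T^{(j)}`, i.e. lies in the kernel `𝔪^{e_j} T^{(k)}`).
[cite: Howard2004HeegnerKolyvagin, §1.6 (arXiv p. 11 L33–38) with Def. 1.2.1] -/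
theorem sub_mem_pow_smul_top_of_forall_apply_eq (S : DVRSetting p K R N Rk Nbar Nq)
    (hy : S.SatisfiesH) (j : ℕ) {σ : absoluteGaloisGroup K} (hσ : ∀ x : N j, S.T.ρ j σ x = x)
    (k : ℕ) (x : N k) :
    S.T.ρ k σ x - x ∈ (IsLocalRing.maximalIdeal R ^ S.e j) • (⊤ : Submodule R (N k)) := by
  rcases le_total k j with hkj | hjk
  · -- `k ≤ j`: `T^{(k)}` is a quotient of `T^{(j)}`
    obtain ⟨d, rfl⟩ := Nat.exists_eq_add_of_le hkj
    obtain ⟨y, rfl⟩ := S.T.redIter_surjective k d x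
    rw [← S.T.redIter_equivariant k d σ y, hσ, sub_self]
    exact Submodule.zero_mem _
  · -- `j ≤ k`: the difference reduces to `0` in `T^{(j)}`
    obtain ⟨d, rfl⟩ := Nat.exists_eq_add_of_le hjk
    refine ker_redIter_le S hy j d ?_
    rw [LinearMap.mem_ker, map_sub, S.T.redIter_equivariant j d σ x, hσ, sub_self]

/-! ## §2 When `p ≠ 0` in `R`: a level with `𝔪^{e_j} ⊆ (p^s)` -/

/-- **Some level has `𝔪^{e_j} ⊆ p^s R`** when `p ≠ 0` in the DVR `R` (then `(p^s) = 𝔪^n` for some `n`,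
and `e_j ≥ n` for `j ≥ n` since `e` is strictly increasing).  This is where characteristic `0` of the
coefficient ring enters Howard's «`ℓ ∈ 𝓛_{2k−1}`».
[cite: Howard2004HeegnerKolyvagin, Def. 1.2.1 («I_ℓ ⊂ p^k ℤ_p») and §1.6 (arXiv p. 11 L33–38)] -/
theorem exists_maximalIdeal_pow_e_le_span_pow (S : DVRSetting p K R N Rk Nbar Nq) (hy : S.SatisfiesH)
    (hp0 : ((p : ℕ) : R) ≠ 0) (s : ℕ) :
    ∃ j : ℕ, IsLocalRing.maximalIdeal R ^ S.e j ≤ Ideal.span {((p : ℕ) : R) ^ s} := by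
  have hπ : Irreducible S.π := (IsDiscreteValuationRing.irreducible_iff_uniformizer S.π).mpr hy.unif
  have hne : Ideal.span {((p : ℕ) : R) ^ s} ≠ ⊥ := by
    rw [Ne, Ideal.span_singleton_eq_bot]
    exact pow_ne_zero s hp0
  obtain ⟨n, hn⟩ := IsDiscreteValuationRing.ideal_eq_span_pow_irreducible hne hπ
  refine ⟨n, ?_⟩
  rw [hn, hy.unif, Ideal.span_singleton_pow]
  exact Ideal.span_singleton_le_span_singleton.mpr
    (pow_dvd_pow S.π (hy.e_strictMono.id_le n))

/-! ## §3 One Frobenius trivial on an unramified level ⇒ every Frobenius trivial there -/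

/-- **If one arithmetic Frobenius at `λ` acts trivially on the level `T^{(j)}`, unramified at `λ`,
then every arithmetic Frobenius at `λ` does**: primes of `\bar ℤ_K` above `λ` are conjugate
(`exists_smul_eq_of_mem_primesAbove_holds`), two Frobenii at one prime differ by inertia
(`IsArithFrobAt.mul_inv_mem_inertia`), and inertia acts trivially (`GaloisRep.IsUnramifiedAt`).
[cite: NeukirchANT1999, Ch. I §9 Prop. (9.4)–(9.6)] -/
theorem forall_apply_eq_of_isArithFrobAtPlace (S : DVRSetting p K R N Rk Nbar Nq) (j : ℕ)
    {v : HeightOneSpectrum (𝓞 K)} (hur : GaloisRep.IsUnramifiedAt v (S.T.ρ j))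
    {𝔔 : Ideal (absIntegers (𝓞 K) K)} (h𝔔 : 𝔔 ∈ v.primesAbove) {F : absoluteGaloisGroup K}
    (hF : IsArithFrobAt (𝓞 K) F 𝔔) (hFj : ∀ x : N j, S.T.ρ j F x = x)
    {σ : absoluteGaloisGroup K} (hσ : IsArithFrobAtPlace K v σ) (x : N j) : S.T.ρ j σ x = x := by
  obtain ⟨𝔓, h𝔓, hσ𝔓⟩ := hσ
  haveI : 𝔔.IsPrime := h𝔔.1
  haveI : 𝔓.IsPrime := h𝔓.1
  obtain ⟨δ, hδ⟩ := HeightOneSpectrum.exists_smul_eq_of_mem_primesAbove_holds h𝔔 h𝔓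
  have hF' : IsArithFrobAt (𝓞 K) (δ * F * δ⁻¹) 𝔓 := by
    have h := hF.conj δ
    rwa [hδ] at h
  -- `σ = i · (δ F δ⁻¹)` with `i` in the inertia group of `𝔓`
  have hi : σ * (δ * F * δ⁻¹)⁻¹ ∈ 𝔓.inertia (absoluteGaloisGroup K) := hσ𝔓.mul_inv_mem_inertia hF'
  have hρi : S.T.ρ j (σ * (δ * F * δ⁻¹)⁻¹) = 1 := hur 𝔓 h𝔓 _ hi
  have hρF' : ∀ y : N j, S.T.ρ j (δ * F * δ⁻¹) y = y := fun y ↦ by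
    have h := hFj (S.T.ρ j δ⁻¹ y)
    rw [map_mul, map_mul, Module.End.mul_apply, Module.End.mul_apply, h, ← Module.End.mul_apply,
      ← map_mul, mul_inv_cancel, map_one, Module.End.one_apply]
  have hσeq : σ = (σ * (δ * F * δ⁻¹)⁻¹) * (δ * F * δ⁻¹) := by group
  rw [hσeq, map_mul, Module.End.mul_apply, hρF', hρi, Module.End.one_apply]

/-! ## §4 Membership in `𝓛_s(T)` and in `𝓛` -/

/-- **«`λ ∈ 𝓛_s(T)`» from one Frobenius** (Howard's `ℓ ∈ 𝓛_{2k−1}` for the primes of Lemma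
1.6.2).  On a `DVRSetting` with H.0–H.5: let `ℓ ≠ p` be a rational prime inert in the quadratic
field `K`, `λ ∋ ℓ` its place with `λ ∉ Σ(F)`, `p^s ∣ ℓ + 1`, `j` a level with `𝔪^{e_j} ⊆ p^s R`
(§2), and suppose some arithmetic Frobenius at `λ` acts trivially on `T^{(j)}` (e.g. Frobenius
`∈ Γ_L`, `L ⊇ K(T^{(j)})`).  Then `λ ∈ 𝓛_s(T)` (`S.T.kolyvaginPrimes p s`): `λ` is of degree two,
prime to `p`, unramified in every level (all levels are unramified outside `Σ(F)`), `ℓ + 1 ∈ p^s R`,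
and EVERY arithmetic Frobenius at `λ` satisfies `Frob x − x ∈ p^s T^{(k)}` on EVERY level (§1, §3).
[cite: Howard2004HeegnerKolyvagin, Def. 1.2.1 and Lemma 1.6.2 (arXiv p. 6 L63–70, p. 11 L48–58)] -/
theorem mem_kolyvaginPrimes_of_isArithFrobAtPlace (S : DVRSetting p K R N Rk Nbar Nq)
    (hy : S.SatisfiesH) (hK2 : Module.finrank ℚ K = 2) {ℓ : ℕ} (hℓ : ℓ.Prime) (hℓp : ℓ ≠ p)
    (hinert : (Ideal.span {(ℓ : 𝓞 K)}).IsPrime) {v : HeightOneSpectrum (𝓞 K)}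
    (hℓv : (ℓ : 𝓞 K) ∈ v.asIdeal) (hvS : (Sum.inr v : Place K) ∉ S.Sigma) {s : ℕ}
    (hdvd : p ^ s ∣ ℓ + 1) {j : ℕ}
    (hj : IsLocalRing.maximalIdeal R ^ S.e j ≤ Ideal.span {((p : ℕ) : R) ^ s})
    {F : absoluteGaloisGroup K} (hF : IsArithFrobAtPlace K v F) (hFj : ∀ x : N j, S.T.ρ j F x = x) :
    v ∈ S.T.kolyvaginPrimes p s := by
  -- unramified at every level: all levels are unramified outside `Σ(F)`
  have hur : ∀ k, GaloisRep.IsUnramifiedAt v (S.T.ρ k) := fun k ↦ by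
    by_contra h
    exact hvS (hy.Sigma_eq k ▸ (S.t k).isHoward.mem_of_ramified v h)
  have hpv : ((p : ℕ) : 𝓞 K) ∉ v.asIdeal := not_natCast_mem_of_prime_ne hℓ (Fact.out) hℓp v hℓv
  have hdeg : IsDegreeTwo v := isDegreeTwo_of_span_natCast_isPrime hK2 hℓ hinert hℓv
  refine ⟨Set.mem_iInter.mpr fun k ↦ ⟨hdeg, hpv, hur k⟩, ?_, fun k σ hσ x ↦ ?_⟩
  · -- `ℓ + 1 ∈ (p^s)`
    have hchar : residueChar v = ℓ := by
      haveI : Nontrivial (𝓞 K ⧸ v.asIdeal) := Ideal.Quotient.nontrivial_iff.mpr v.isPrime.ne_top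
      have h0 : ((ℓ : ℕ) : 𝓞 K ⧸ v.asIdeal) = 0 := by
        rw [← map_natCast (Ideal.Quotient.mk v.asIdeal), Ideal.Quotient.eq_zero_iff_mem]
        exact hℓv
      exact CharP.ringChar_of_prime_eq_zero hℓ h0
    rw [hchar, Ideal.mem_span_singleton, ← Nat.cast_pow]
    exact Nat.cast_dvd_cast hdvd
  · -- every Frobenius, every level
    obtain ⟨𝔔, h𝔔, hF𝔔⟩ := hF
    have hσj : ∀ y : N j, S.T.ρ j σ y = y :=
      S.forall_apply_eq_of_isArithFrobAtPlace j (hur j) h𝔔 hF𝔔 hFj hσ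
    exact Submodule.smul_mono_left hj (S.sub_mem_pow_smul_top_of_forall_apply_eq hy j hσj k x)

/-- **… hence `λ ∈ 𝓛`** under «`𝓛_s(T) ⊂ 𝓛` for `s ≥ s₀`» (`LargePrimes`), for `s ≥ s₀`.
[cite: Howard2004HeegnerKolyvagin, §1.6 (arXiv p. 11 L15–16, L36–38: `𝓛^{(k)} = 𝓛 ∩ 𝓛_k(T)`)] -/
theorem mem_primes_of_isArithFrobAtPlace (S : DVRSetting p K R N Rk Nbar Nq) (hy : S.SatisfiesH)
    {s₀ : ℕ} (hL : ∀ s, s₀ ≤ s → S.T.kolyvaginPrimes p s ⊆ S.L) (hK2 : Module.finrank ℚ K = 2)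
    {ℓ : ℕ} (hℓ : ℓ.Prime) (hℓp : ℓ ≠ p) (hinert : (Ideal.span {(ℓ : 𝓞 K)}).IsPrime)
    {v : HeightOneSpectrum (𝓞 K)} (hℓv : (ℓ : 𝓞 K) ∈ v.asIdeal)
    (hvS : (Sum.inr v : Place K) ∉ S.Sigma) {s : ℕ} (hs : s₀ ≤ s) (hdvd : p ^ s ∣ ℓ + 1) {j : ℕ}
    (hj : IsLocalRing.maximalIdeal R ^ S.e j ≤ Ideal.span {((p : ℕ) : R) ^ s})
    {F : absoluteGaloisGroup K} (hF : IsArithFrobAtPlace K v F) (hFj : ∀ x : N j, S.T.ρ j F x = x) :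
    v ∈ S.L ∧ v ∈ S.T.kolyvaginPrimes p s :=
  have h := S.mem_kolyvaginPrimes_of_isArithFrobAtPlace hy hK2 hℓ hℓp hinert hℓv hvS hdvd hj hF hFj
  ⟨hL s hs h, h⟩

end DVRSetting

end Literature.NumberTheory.GaloisCohomology.Howard2004

end
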